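import Literature.Geometry.Symplectic.JCurveIntersectionCountHomological
import Summits.SmoothPoincare4.SmoothPoincare4.Theorems.SymplecticOrigamiGromovRecognitionRelEndSphereWedgeCountPos
import Mathlib.Analysis.Complex.OpenMapping
import Mathlib.Geometry.Manifold.MFDeriv.SpecificFunctions
import Mathlib.Geometry.Manifold.Algebra.LieGroup
import Mathlib.Algebra.Module.BigOperators
import Mathlib.Algebra.Order.BigOperators.Group.Finset

/-!
# Case (B) of Gromov compactness: the wedge counts single out a trapped bubble
(registered helper `helper_caseBCounts` of line `cross-cap-laurent`, crux `GromovRecognitionRelEnd`,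
item stmt-SmoothPoincare4-11009)

Setting: `X` is a compact almost complex `4`-manifold (`JX`) with two `JX`-holomorphic "wedge
coordinates" `TH` on the open `UH` and `TV` on `UV` (non-vanishing differentials, compact levels
`{T = t}` for `‖t‖ < δ`).  The reference sphere `V∞ = (u₀, v₀)` (glued map `F₀ : ℂℙ¹ → X`) lies in
`{TV = 0}`, misses `UH` at `u₀ 0`, and has count `1` against every `H`-level `{TH = t}`.  Case (B)
of Gromov compactness gives `m ≥ 2` non-constant `JX`-spheres `Bⱼ = (Bu j, Bv j)` (glued maps
`G j`) whose fundamental classes add up to that of `F₀`.  Claim: some `Bⱼ` is inside-or-disjoint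
from `{TH = 0} ∩ UH` and inside-or-disjoint from `{TV = 0} ∩ UV`.

Proof.  (F) The vendored fact `jSphere_wedgeCount_factorsThroughHomology` (a HYPOTHESIS here),
applied to the shifted coordinate `T - t` (same differential, `caseB_mfderiv_sub_const`), gives an
additive `c_t : H₂(X; ℤ) → ℤ` computing the count of every `JX`-sphere not inside the level `K_t`.
(P) Zero persistence (`caseB_persist`): a sphere meeting `K_0` without lying in it meets every
nearby level — `T ∘ u` is holomorphic (`helper_holCoordCompJHol`) with a zero that is not interior
to the zero set (`interior_zeroSet_eq_empty`), so by the open mapping theorem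
(`AnalyticAt.eventually_constant_or_nhds_le_map_nhds`) every small `t` is a value.
(C) `t ≠ 0`, `‖t‖ < δ`, "no bubble inside `K_t`" and persistence for every bubble all hold
eventually along the non-trivial filter `𝓝[≠] 0`: pick such `t` (for `TH`) and `s` (for `TV`).
(S) Counting (`caseB_card_le`): counts are `≥ 0`, and `≥ 1` for a bubble meeting the level
(`helper_sphereWedgeCountPos`); by additivity of `c_t` they sum to the count of `V∞`, `1` for
`TH - t` (hypothesis) and `0` for `TV - s` (`V∞ ⊆ {TV = 0}`, `s ≠ 0`).  So at most one bubble
meets `K_t^H`, none meets `K_s^V`; as `m ≥ 2` some bubble misses both, and by (P) it is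
inside-or-disjoint from both zero levels (`caseB_conclude`).

References: C. Wendl, *Holomorphic Curves in Low Dimensions* (2018), §2.2.2; D. McDuff,
D. Salamon, *J-holomorphic Curves and Symplectic Topology* (2012), §2.6, App. E; open mapping
theorem (Mathlib `Mathlib.Analysis.Complex.OpenMapping`).  No new definitions or instances.
-/

noncomputable section

-- the prescribed namespace `Summit.<P>.<Sub>.…` duplicates `SmoothPoincare4` (P = Sub)
set_option linter.dupNamespace false

open scoped Manifold ContDiff Topology
open Set Function Filter Literature.Topology.FourManifolds
  Literature.Topology.FourManifolds.ComplexProjectiveSpace Literature.Geometry.Kaehler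
  Literature.Geometry.Symplectic Literature.AlgebraicTopology.SingularHomology

namespace Summit.SmoothPoincare4.SmoothPoincare4.Theorems.GromovRecognitionRelEnd.CrossCapLaurent

/-- **The point at infinity of a two-chart sphere lies in every closed set containing the affine
chart.** If `K` is closed, `v` is continuous, `v w = u w⁻¹` for `w ≠ 0` and all `u z ∈ K`, then
`v 0 ∈ K` (`v 0` is the limit of `v w = u w⁻¹ ∈ K` along `𝓝[≠] 0`). -/
theorem caseB_mem_of_forall_mem {X : Type} [TopologicalSpace X] {K : Set X} (hK : IsClosed K)
    {u v : ℂ → X} (hv : Continuous v) (huv : ∀ z : ℂ, z ≠ 0 → v z = u z⁻¹)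
    (h : ∀ z, u z ∈ K) : v 0 ∈ K := by
  have h1 : ∀ᶠ w in 𝓝[≠] (0 : ℂ), v w ∈ K := by
    filter_upwards [self_mem_nhdsWithin] with w hw using huv w hw ▸ h _
  exact hK.mem_of_tendsto (hv.continuousAt.tendsto.mono_left nhdsWithin_le_nhds) h1

/-- **Shifting a coordinate by a constant does not change its differential**: for `T` smooth on
the open set `U`, `y ∈ U`, the `mfderiv` of `fun y => T y - t` at `y` is that of `T`
(`HasMFDerivAt.sub`, `hasMFDerivAt_const`). -/
theorem caseB_mfderiv_sub_const {X : Type} [TopologicalSpace X]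
    [ChartedSpace (EuclideanSpace ℝ (Fin 4)) X] [IsManifold (𝓡 4) ∞ X] {T : X → ℂ} {U : Set X}
    (hU : IsOpen U) (hT : ContMDiffOn (𝓡 4) 𝓘(ℝ, ℂ) ∞ T U) (t : ℂ) {y : X} (hy : y ∈ U) :
    mfderiv (𝓡 4) 𝓘(ℝ, ℂ) (fun y => T y - t) y = mfderiv (𝓡 4) 𝓘(ℝ, ℂ) T y := by
  have hTy : MDifferentiableAt (𝓡 4) 𝓘(ℝ, ℂ) T y :=
    (hT.contMDiffAt (hU.mem_nhds hy)).mdifferentiableAt (by simp)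
  have hc : HasMFDerivAt (𝓡 4) 𝓘(ℝ, ℂ) (fun _ : X => t) y (0 : TangentSpace (𝓡 4) y →L[ℝ] ℂ) :=
    hasMFDerivAt_const t y
  have h := hTy.hasMFDerivAt.sub hc
  rw [sub_zero] at h
  exact h.mfderiv

/-- **Open mapping step.** If `F` is analytic at `z₁`, `F z₁ = 0`, `F` is non-zero on a punctured
neighbourhood of `z₁`, and `W` is a neighbourhood of `z₁`, then every `t` near `0` is a value
`F z` with `z ∈ W` (`AnalyticAt.eventually_constant_or_nhds_le_map_nhds`; the constant
alternative contradicts the punctured non-vanishing since `𝓝[≠] z₁ ≠ ⊥`). -/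
theorem caseB_openMap {F : ℂ → ℂ} {W : Set ℂ} {z₁ : ℂ} (hF : AnalyticAt ℂ F z₁) (h0 : F z₁ = 0)
    (hne : ∀ᶠ w in 𝓝[≠] z₁, F w ≠ 0) (hW : W ∈ 𝓝 z₁) :
    ∀ᶠ t in 𝓝 (0 : ℂ), ∃ z, z ∈ W ∧ F z = t := by
  rcases hF.eventually_constant_or_nhds_le_map_nhds with h | h
  · have h2 : ∀ᶠ w in 𝓝[≠] z₁, False := by
      filter_upwards [hne, h.filter_mono nhdsWithin_le_nhds] with w h1 h2
      exact h1 (h2.trans h0)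
    exact h2.exists.choose_spec.elim
  · rw [h0] at h
    exact h (image_mem_map hW)

/-- **Zero persistence.** Let `T` be smooth and `JX`-holomorphic on the open set `U` with
`K₀ = {y ∈ U | T y = 0}` closed, and `(u, v)` a `JX`-holomorphic two-chart sphere not inside `K₀`
(some `u z ∉ K₀`) but meeting it (at some `u z`, or at `v 0`).  Then for all `t` near `0` the
sphere meets the level `{y ∈ U | T y = t}`: `T ∘ u` (resp. `T ∘ v`) is holomorphic with a zero
that is not interior to its zero set (isolated zeros; at `v 0` transport through `v w = u w⁻¹`,
`helper_sphereWedgeZerosFinite`), hence open there. -/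
theorem caseB_persist {X : Type} [TopologicalSpace X] [ChartedSpace (EuclideanSpace ℝ (Fin 4)) X]
    [IsManifold (𝓡 4) ∞ X] (JX : ∀ y : X, TangentSpace (𝓡 4) y →L[ℝ] TangentSpace (𝓡 4) y)
    (T : X → ℂ) (U : Set X) (u v : ℂ → X) (hU : IsOpen U)
    (hT : ContMDiffOn (𝓡 4) 𝓘(ℝ, ℂ) ∞ T U)
    (hTJ : ∀ y ∈ U, ∀ w : TangentSpace (𝓡 4) y, (show ℂ from mfderiv (𝓡 4) 𝓘(ℝ, ℂ) T y (JX y w)) =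
      Complex.I * (show ℂ from mfderiv (𝓡 4) 𝓘(ℝ, ℂ) T y w))
    (hcl : IsClosed {y : X | y ∈ U ∧ T y = 0})
    (hu : ContMDiff 𝓘(ℝ, ℂ) (𝓡 4) ∞ u) (hv : ContMDiff 𝓘(ℝ, ℂ) (𝓡 4) ∞ v)
    (huv : ∀ z : ℂ, z ≠ 0 → v z = u z⁻¹)
    (hJu : IsJHolomorphic (𝓡 4) JX u) (hJv : IsJHolomorphic (𝓡 4) JX v)
    (hnot : ∃ z : ℂ, ¬ (u z ∈ U ∧ T (u z) = 0))
    (hmeet : (∃ z : ℂ, u z ∈ U ∧ T (u z) = 0) ∨ (v 0 ∈ U ∧ T (v 0) = 0)) :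
    ∀ᶠ t in 𝓝 (0 : ℂ), (∃ z : ℂ, u z ∈ U ∧ T (u z) = t) ∨ (v 0 ∈ U ∧ T (v 0) = t) := by
  have hO : IsOpen (u ⁻¹' U) := hU.preimage hu.continuous
  have hV : IsOpen (v ⁻¹' U) := hU.preimage hv.continuous
  have hf : AnalyticOnNhd ℂ (T ∘ u) (u ⁻¹' U) :=
    (helper_holCoordCompJHol X JX T U u hU hT hTJ hu hJu).analyticOnNhd hO
  have hg : AnalyticOnNhd ℂ (T ∘ v) (v ⁻¹' U) :=
    (helper_holCoordCompJHol X JX T U v hU hT hTJ hv hJv).analyticOnNhd hV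
  have hint : interior {z : ℂ | u z ∈ U ∧ T (u z) = 0} = ∅ :=
    interior_zeroSet_eq_empty (f := T ∘ u) (O := u ⁻¹' U) hO hf (hcl.preimage hu.continuous) hnot
  rcases hmeet with ⟨z₁, hz₁⟩ | h0
  · -- the sphere meets `K₀` in the affine chart: `T ∘ u` is open at `z₁`
    have hne : ∀ᶠ w in 𝓝[≠] z₁, (T ∘ u) w ≠ 0 :=
      eventually_ne_zero_of_interior_zeroSet_eq_empty (f := T ∘ u) (O := u ⁻¹' U) hO hf hint hz₁.1
    exact (caseB_openMap (hf z₁ hz₁.1) hz₁.2 hne (hO.mem_nhds hz₁.1)).mono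
      fun t ⟨z, hz, hzt⟩ => Or.inl ⟨z, hz, hzt⟩
  · -- the sphere meets `K₀` at the point at infinity: `T ∘ v` is open at `0`
    have hfin : {z : ℂ | u z ∈ U ∧ T (u z) = 0}.Finite :=
      helper_sphereWedgeZerosFinite X JX T U u v hU hT hTJ hcl hu hv huv hJu hJv hnot
    -- `T ∘ v ≢ 0` near `0`: else the (finite) zero set of `T ∘ u` would be a neighbourhood of `∞`
    have hne : ∀ᶠ w in 𝓝[≠] (0 : ℂ), (T ∘ v) w ≠ 0 := by
      rcases (hg 0 h0.1).eventually_eq_zero_or_eventually_ne_zero with h4 | h4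
      · exfalso
        have h5 : ∀ᶠ w in 𝓝[≠] (0 : ℂ), w⁻¹ ∈ {z : ℂ | u z ∈ U ∧ T (u z) = 0} := by
          have h4' : ∀ᶠ w in 𝓝[≠] (0 : ℂ), (T ∘ v) w = 0 ∧ v w ∈ U :=
            nhdsWithin_le_nhds (h4.and (hV.mem_nhds h0.1))
          filter_upwards [h4', self_mem_nhdsWithin] with w hw hw0
          show u w⁻¹ ∈ U ∧ T (u w⁻¹) = 0
          rw [← huv w hw0]
          exact ⟨hw.2, hw.1⟩
        have h6 : ∀ᶠ z in Bornology.cobounded ℂ, z ∈ {z : ℂ | u z ∈ U ∧ T (u z) = 0} := by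
          simpa only [inv_inv] using Filter.tendsto_inv₀_cobounded'.eventually h5
        have h7 : ∀ᶠ z in Bornology.cobounded ℂ, z ∉ {z : ℂ | u z ∈ U ∧ T (u z) = 0} :=
          Bornology.isBounded_def.mp hfin.isBounded
        obtain ⟨z, hz, hz'⟩ := (h6.and h7).exists
        exact hz' hz
      · exact h4
    filter_upwards [caseB_openMap (hg 0 h0.1) h0.2 hne (hV.mem_nhds h0.1)] with t ht
    obtain ⟨w, hw, hwt⟩ := ht
    by_cases hw0 : w = 0
    · subst hw0
      exact Or.inr ⟨hw, hwt⟩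
    · rw [Function.comp_apply, huv w hw0] at hwt
      rw [mem_preimage, huv w hw0] at hw
      exact Or.inl ⟨w⁻¹, hw, hwt⟩

/-- **Inside-or-disjoint from a missed level.** By (contrapositive) zero persistence, a sphere
missing the level `t` is inside `K₀ = {y ∈ U | T y = 0}` (point at infinity included,
`caseB_mem_of_forall_mem`) or disjoint from it. -/
theorem caseB_conclude {X : Type} [TopologicalSpace X] {T : X → ℂ} {U : Set X} {u v : ℂ → X}
    (hcl : IsClosed {y : X | y ∈ U ∧ T y = 0}) (hv : Continuous v)
    (huv : ∀ z : ℂ, z ≠ 0 → v z = u z⁻¹) {t : ℂ}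
    (hper : (∃ z : ℂ, ¬ (u z ∈ U ∧ T (u z) = 0)) ∧
        ((∃ z : ℂ, u z ∈ U ∧ T (u z) = 0) ∨ (v 0 ∈ U ∧ T (v 0) = 0)) →
      (∃ z : ℂ, u z ∈ U ∧ T (u z) = t) ∨ (v 0 ∈ U ∧ T (v 0) = t))
    (hmiss : ¬ ((∃ z : ℂ, u z ∈ U ∧ T (u z) = t) ∨ (v 0 ∈ U ∧ T (v 0) = t))) :
    ((∀ z : ℂ, u z ∈ U ∧ T (u z) = 0) ∧ (v 0 ∈ U ∧ T (v 0) = 0)) ∨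
      ((∀ z : ℂ, ¬ (u z ∈ U ∧ T (u z) = 0)) ∧ ¬ (v 0 ∈ U ∧ T (v 0) = 0)) := by
  by_cases hall : ∀ z : ℂ, u z ∈ U ∧ T (u z) = 0
  · exact Or.inl ⟨hall, caseB_mem_of_forall_mem (K := {y : X | y ∈ U ∧ T y = 0}) hcl hv huv hall⟩
  · have hnm : ¬ ((∃ z : ℂ, u z ∈ U ∧ T (u z) = 0) ∨ (v 0 ∈ U ∧ T (v 0) = 0)) := fun hm =>
      hmiss (hper ⟨not_forall.mp hall, hm⟩)
    exact Or.inr ⟨fun z hz => hnm (Or.inl ⟨z, hz⟩), fun h0 => hnm (Or.inr h0)⟩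

/-- **Generic levels.** Along the punctured neighbourhood filter of `0`, eventually `‖t‖ < δ` and
no bubble has its whole affine chart inside the level `{y ∈ U | T y = t}` (the only candidate
level for `Bu j` is `t = T (Bu j 0)`, avoided near `0` if non-zero and by the puncture if zero). -/
theorem caseB_generic {X : Type} {m : ℕ} (T : X → ℂ) (U : Set X) (Bu : Fin m → ℂ → X) {δ : ℝ}
    (hδ : 0 < δ) :
    ∀ᶠ t in 𝓝[≠] (0 : ℂ), ‖t‖ < δ ∧ ∀ j, ∃ z : ℂ, ¬ (Bu j z ∈ U ∧ T (Bu j z) = t) := by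
  have h1 : ∀ᶠ t in 𝓝[≠] (0 : ℂ), ‖t‖ < δ := by
    filter_upwards [mem_nhdsWithin_of_mem_nhds (Metric.ball_mem_nhds (0 : ℂ) hδ)] with t ht
    simpa using ht
  have h2 : ∀ j, ∀ᶠ t in 𝓝[≠] (0 : ℂ), ∃ z : ℂ, ¬ (Bu j z ∈ U ∧ T (Bu j z) = t) := by
    intro j
    have h3 : ∀ᶠ t in 𝓝[≠] (0 : ℂ), t ≠ T (Bu j 0) := by
      by_cases hc : T (Bu j 0) = 0
      · rw [hc]
        exact self_mem_nhdsWithin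
      · exact mem_nhdsWithin_of_mem_nhds (isOpen_ne.mem_nhds (Ne.symm hc))
    exact h3.mono fun t ht => ⟨0, fun h => ht h.2.symm⟩
  exact h1.and (Filter.eventually_all.mpr h2)

/-- **Counting against a level.** Let `T` be smooth and `JX`-holomorphic on the open `U` with
non-vanishing differential and compact level `K_t = {y ∈ U | T y = t}`; let `(u₀, v₀)` (glued map
`F₀`) be a reference `JX`-sphere not inside `K_t`, and `Bⱼ = (Bu j, Bv j)` (glued maps `G j`)
bubbles, none inside `K_t`, with `Σⱼ (G j)_*[ℂℙ¹] = (F₀)_*[ℂℙ¹]`.  Then the number of bubbles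
meeting `K_t` is at most the count of `(u₀, v₀)` against `T - t`: the functional `c_t` of
`jSphere_wedgeCount_factorsThroughHomology` computes all these counts, each is `≥ 0` and `≥ 1` for
a bubble meeting `K_t` (`helper_sphereWedgeCountPos`), and `Σⱼ c_t (G j)_* = c_t (F₀)_*`. -/
theorem caseB_card_le {X : Type} [TopologicalSpace X] [T2Space X] [SecondCountableTopology X]
    [CompactSpace X] [ChartedSpace (EuclideanSpace ℝ (Fin 4)) X] [IsManifold (𝓡 4) ∞ X]
    (JX : AlmostComplexStructure (𝓡 4) ∞ X) (hfact : jSphere_wedgeCount_factorsThroughHomology)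
    (T : X → ℂ) (U : Set X) (t : ℂ) (u₀ v₀ : ℂ → X) (F₀ : C(ComplexProjectiveSpace 1, X)) (m : ℕ)
    (Bu Bv : Fin m → ℂ → X) (G : Fin m → C(ComplexProjectiveSpace 1, X))
    (hU : IsOpen U) (hT : ContMDiffOn (𝓡 4) 𝓘(ℝ, ℂ) ∞ T U)
    (hTJ : ∀ y ∈ U, ∀ w : TangentSpace (𝓡 4) y, (show ℂ from mfderiv (𝓡 4) 𝓘(ℝ, ℂ) T y (JX y w)) =
      Complex.I * (show ℂ from mfderiv (𝓡 4) 𝓘(ℝ, ℂ) T y w))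
    (hdT : ∀ y ∈ U, mfderiv (𝓡 4) 𝓘(ℝ, ℂ) T y ≠ 0) (hK : IsCompact {y : X | y ∈ U ∧ T y = t})
    (hu₀ : ContMDiff 𝓘(ℝ, ℂ) (𝓡 4) ∞ u₀) (hv₀ : ContMDiff 𝓘(ℝ, ℂ) (𝓡 4) ∞ v₀)
    (huv₀ : ∀ z : ℂ, z ≠ 0 → v₀ z = u₀ z⁻¹)
    (hJu₀ : IsJHolomorphic (𝓡 4) (fun y => JX y) u₀)
    (hJv₀ : IsJHolomorphic (𝓡 4) (fun y => JX y) v₀)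
    (hF₀u : ∀ p, CoordNeZero 0 p → F₀ p = u₀ (affineCoordComplex 0 p 0))
    (hF₀v : ∀ p, CoordNeZero 1 p → F₀ p = v₀ (affineCoordComplex 1 p 0))
    (h₀ : ∃ z : ℂ, ¬ (u₀ z ∈ U ∧ T (u₀ z) = t))
    (hB : ∀ j, ContMDiff 𝓘(ℝ, ℂ) (𝓡 4) ∞ (Bu j) ∧ ContMDiff 𝓘(ℝ, ℂ) (𝓡 4) ∞ (Bv j) ∧
      (∀ z : ℂ, z ≠ 0 → Bv j z = Bu j z⁻¹) ∧
      IsJHolomorphic (𝓡 4) (fun y => JX y) (Bu j) ∧ IsJHolomorphic (𝓡 4) (fun y => JX y) (Bv j) ∧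
      (∃ z, Bu j z ≠ Bu j 0) ∧
      (∀ p, CoordNeZero 0 p → G j p = Bu j (affineCoordComplex 0 p 0)) ∧
      (∀ p, CoordNeZero 1 p → G j p = Bv j (affineCoordComplex 1 p 0)))
    (hsum : ∑ j, singularHomology.map ℤ ℤ (G j) (2 * 1)
        (ComplexProjectiveSpace.homologicalOrientationInt 1).fundamentalClass =
      singularHomology.map ℤ ℤ F₀ (2 * 1)
        (ComplexProjectiveSpace.homologicalOrientationInt 1).fundamentalClass)
    (hBnot : ∀ j, ∃ z : ℂ, ¬ (Bu j z ∈ U ∧ T (Bu j z) = t)) (S : Finset (Fin m))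
    (hS : ∀ j ∈ S, (∃ z : ℂ, Bu j z ∈ U ∧ T (Bu j z) = t) ∨ (Bv j 0 ∈ U ∧ T (Bv j 0) = t)) :
    (S.card : ℤ) ≤
      (∑ᶠ z ∈ {z : ℂ | u₀ z ∈ U ∧ (fun y => T y - t) (u₀ z) = 0},
          (meromorphicOrderAt ((fun y => T y - t) ∘ u₀) z).untop₀) +
        (∑ᶠ w ∈ {w : ℂ | w = 0 ∧ v₀ w ∈ U ∧ (fun y => T y - t) (v₀ w) = 0},
          (meromorphicOrderAt ((fun y => T y - t) ∘ v₀) w).untop₀) := by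
  have hT' : ContMDiffOn (𝓡 4) 𝓘(ℝ, ℂ) ∞ (fun y => T y - t) U := hT.sub contMDiffOn_const
  have hTJ' : ∀ y ∈ U, ∀ w : TangentSpace (𝓡 4) y,
      (show ℂ from mfderiv (𝓡 4) 𝓘(ℝ, ℂ) (fun y => T y - t) y (JX y w)) =
        Complex.I * (show ℂ from mfderiv (𝓡 4) 𝓘(ℝ, ℂ) (fun y => T y - t) y w) :=
    fun y hy w => by rw [caseB_mfderiv_sub_const hU hT t hy]; exact hTJ y hy w
  have hdT' : ∀ y ∈ U, mfderiv (𝓡 4) 𝓘(ℝ, ℂ) (fun y => T y - t) y ≠ 0 :=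
    fun y hy => by rw [caseB_mfderiv_sub_const hU hT t hy]; exact hdT y hy
  have hK' : IsCompact {y : X | y ∈ U ∧ (fun y => T y - t) y = 0} := by
    simpa only [sub_eq_zero] using hK
  have hcl' : IsClosed {y : X | y ∈ U ∧ (fun y => T y - t) y = 0} := hK'.isClosed
  obtain ⟨c, hc⟩ := hfact X JX (fun y => T y - t) U hU hT' hTJ' hdT' hK'
  have hBnot' : ∀ j, ∃ z : ℂ, ¬ (Bu j z ∈ U ∧ (fun y => T y - t) (Bu j z) = 0) := by
    simpa only [sub_eq_zero] using hBnot
  -- each bubble: its count is `c` of its class, nonnegative, and `≥ 1` if it meets the level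
  have hpos : ∀ j, 0 ≤ c (singularHomology.map ℤ ℤ (G j) (2 * 1)
        (ComplexProjectiveSpace.homologicalOrientationInt 1).fundamentalClass) ∧
      (((∃ z : ℂ, Bu j z ∈ U ∧ (fun y => T y - t) (Bu j z) = 0) ∨
          (Bv j 0 ∈ U ∧ (fun y => T y - t) (Bv j 0) = 0)) →
        1 ≤ c (singularHomology.map ℤ ℤ (G j) (2 * 1)
          (ComplexProjectiveSpace.homologicalOrientationInt 1).fundamentalClass)) := by
    intro j
    obtain ⟨hu, hv, huv, hJu, hJv, -, hGu, hGv⟩ := hB j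
    rw [hc (Bu j) (Bv j) (G j) hu hv huv hJu hJv hGu hGv (hBnot' j)]
    exact helper_sphereWedgeCountPos X (fun y => JX y) (fun y => T y - t) U (Bu j) (Bv j) hU hT'
      hTJ' hcl' hu hv huv hJu hJv (hBnot' j)
  have h₀' : ∃ z : ℂ, ¬ (u₀ z ∈ U ∧ (fun y => T y - t) (u₀ z) = 0) := by
    simpa only [sub_eq_zero] using h₀
  have hc₀ := hc u₀ v₀ F₀ hu₀ hv₀ huv₀ hJu₀ hJv₀ hF₀u hF₀v h₀'
  have hS' : ∀ j ∈ S, 1 ≤ c (singularHomology.map ℤ ℤ (G j) (2 * 1)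
      (ComplexProjectiveSpace.homologicalOrientationInt 1).fundamentalClass) := fun j hj =>
    (hpos j).2 (by simpa only [sub_eq_zero] using hS j hj)
  have hle : (S.card : ℤ) ≤ c (singularHomology.map ℤ ℤ F₀ (2 * 1)
      (ComplexProjectiveSpace.homologicalOrientationInt 1).fundamentalClass) := by
    rw [← hsum, map_sum, Finset.cast_card]
    exact (Finset.sum_le_sum hS').trans
      (Finset.sum_le_univ_sum_of_nonneg fun j => (hpos j).1)
  exact hle.trans_eq hc₀

/-- **Registered helper `helper_caseBCounts`** (line `cross-cap-laurent`, signature verbatim): in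
case (B) of Gromov compactness, with the two wedge coordinates `TH` (on `UH`) and `TV` (on `UV`)
having non-vanishing differentials and compact small levels, the reference sphere `V∞ = (u₀, v₀)`
inside `{TV = 0}`, off `UH` at `u₀ 0` and of count `1` against every `H`-level, and `m ≥ 2`
non-constant bubbles whose classes add up to that of `V∞`, some bubble is inside-or-disjoint from
`{TH = 0} ∩ UH` and inside-or-disjoint from `{TV = 0} ∩ UV`.  See the file header for the proof
(generic levels, zero persistence by the open mapping theorem, additivity of the homological
count `jSphere_wedgeCount_factorsThroughHomology`, positivity `helper_sphereWedgeCountPos`). -/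
theorem helper_caseBCounts : ∀ (X : Type) [TopologicalSpace X] [T2Space X] [SecondCountableTopology X] [CompactSpace X] [ChartedSpace (EuclideanSpace ℝ (Fin 4)) X] [IsManifold (𝓡 4) ∞ X] (JX : AlmostComplexStructure (𝓡 4) ∞ X), jSphere_wedgeCount_factorsThroughHomology → ∀ (TH TV : X → ℂ) (UH UV : Set X) (δ : ℝ) (u₀ v₀ : ℂ → X) (F₀ : C(ComplexProjectiveSpace 1, X)) (m : ℕ) (Bu Bv : Fin m → ℂ → X) (G : Fin m → C(ComplexProjectiveSpace 1, X)), IsOpen UH → ContMDiffOn (𝓡 4) 𝓘(ℝ, ℂ) ∞ TH UH → (∀ y ∈ UH, ∀ w : TangentSpace (𝓡 4) y, (show ℂ from mfderiv (𝓡 4) 𝓘(ℝ, ℂ) TH y (JX y w)) = Complex.I * (show ℂ from mfderiv (𝓡 4) 𝓘(ℝ, ℂ) TH y w)) → (∀ y ∈ UH, mfderiv (𝓡 4) 𝓘(ℝ, ℂ) TH y ≠ 0) → (∀ t : ℂ, ‖t‖ < δ → IsCompact {y : X | y ∈ UH ∧ TH y = t}) → IsOpen UV → ContMDiffOn (𝓡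 4) 𝓘(ℝ, ℂ) ∞ TV UV → (∀ y ∈ UV, ∀ w : TangentSpace (𝓡 4) y, (show ℂ from mfderiv (𝓡 4) 𝓘(ℝ, ℂ) TV y (JX y w)) = Complex.I * (show ℂ from mfderiv (𝓡 4) 𝓘(ℝ, ℂ) TV y w)) → (∀ y ∈ UV, mfderiv (𝓡 4) 𝓘(ℝ, ℂ) TV y ≠ 0) → (∀ s : ℂ, ‖s‖ < δ → IsCompact {y : X | y ∈ UV ∧ TV y = s}) → 0 < δ → ContMDiff 𝓘(ℝ, ℂ) (𝓡 4) ∞ u₀ → ContMDiff 𝓘(ℝ, ℂ) (𝓡 4) ∞ v₀ → (∀ z : ℂ, z ≠ 0 → v₀ z = u₀ z⁻¹) → IsJHolomorphic (𝓡 4) (fun y => JX y) u₀ → IsJHolomorphic (𝓡 4) (fun y => JX y) v₀ → (∀ p, CoordNeZero 0 p → F₀ p = u₀ (affineCoordComplex 0 p 0)) → (∀ p, CoordNeZero 1 p → F₀ p = v₀ (affineCoordComplex 1 p 0)) → (∀ z : ℂ, u₀ z ∈ UV ∧ TV (u₀ z) = 0) → (v₀ 0 ∈ UV ∧ TV (v₀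 0) = 0) → u₀ 0 ∉ UH → (∀ t : ℂ, ‖t‖ < δ → (∑ᶠ z ∈ {z : ℂ | u₀ z ∈ UH ∧ (fun y => TH y - t) (u₀ z) = 0}, (meromorphicOrderAt ((fun y => TH y - t) ∘ u₀) z).untop₀) + (∑ᶠ w ∈ {w : ℂ | w = 0 ∧ v₀ w ∈ UH ∧ (fun y => TH y - t) (v₀ w) = 0}, (meromorphicOrderAt ((fun y => TH y - t) ∘ v₀) w).untop₀) = 1) → 2 ≤ m → (∀ j, ContMDiff 𝓘(ℝ, ℂ) (𝓡 4) ∞ (Bu j) ∧ ContMDiff 𝓘(ℝ, ℂ) (𝓡 4) ∞ (Bv j) ∧ (∀ z : ℂ, z ≠ 0 → Bv j z = Bu j z⁻¹) ∧ IsJHolomorphic (𝓡 4) (fun y => JX y) (Bu j) ∧ IsJHolomorphic (𝓡 4) (fun y => JX y) (Bv j) ∧ (∃ z, Bu j z ≠ Bu j 0) ∧ (∀ p, CoordNeZero 0 p → G j p = Bu j (affineCoordComplex 0 p 0)) ∧ (∀ p, CoordNeZero 1 p → G j p = Bv j (affineCoordComplex 1 p 0))) → (∑ j, singularHomology.map ℤ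 ℤ (G j) (2 * 1) (ComplexProjectiveSpace.homologicalOrientationInt 1).fundamentalClass = singularHomology.map ℤ ℤ F₀ (2 * 1) (ComplexProjectiveSpace.homologicalOrientationInt 1).fundamentalClass) → ∃ j, (((∀ z : ℂ, Bu j z ∈ UH ∧ TH (Bu j z) = 0) ∧ (Bv j 0 ∈ UH ∧ TH (Bv j 0) = 0)) ∨ ((∀ z : ℂ, ¬ (Bu j z ∈ UH ∧ TH (Bu j z) = 0)) ∧ ¬ (Bv j 0 ∈ UH ∧ TH (Bv j 0) = 0))) ∧ (((∀ z : ℂ, Bu j z ∈ UV ∧ TV (Bu j z) = 0) ∧ (Bv j 0 ∈ UV ∧ TV (Bv j 0) = 0)) ∨ ((∀ z : ℂ, ¬ (Bu j z ∈ UV ∧ TV (Bu j z) = 0)) ∧ ¬ (Bv j 0 ∈ UV ∧ TV (Bv j 0) = 0))) := by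
  intro X _ _ _ _ _ _ JX hfact TH TV UH UV δ u₀ v₀ F₀ m Bu Bv G hUH hTH hTHJ hdTH hKH hUV hTV hTVJ
    hdTV hKV hδ hu₀ hv₀ huv₀ hJu₀ hJv₀ hF₀u hF₀v hV₀ hV₀' hH₀ hcnt hm hB hsum
  have hclH : IsClosed {y : X | y ∈ UH ∧ TH y = 0} := (hKH 0 (by simpa using hδ)).isClosed
  have hclV : IsClosed {y : X | y ∈ UV ∧ TV y = 0} := (hKV 0 (by simpa using hδ)).isClosed
  -- (P) zero persistence for every bubble, eventually along `𝓝[≠] 0`, for a coordinate `T`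
  have hper : ∀ (T : X → ℂ) (U : Set X), IsOpen U → ContMDiffOn (𝓡 4) 𝓘(ℝ, ℂ) ∞ T U →
      (∀ y ∈ U, ∀ w : TangentSpace (𝓡 4) y, (show ℂ from mfderiv (𝓡 4) 𝓘(ℝ, ℂ) T y (JX y w)) =
        Complex.I * (show ℂ from mfderiv (𝓡 4) 𝓘(ℝ, ℂ) T y w)) →
      IsClosed {y : X | y ∈ U ∧ T y = 0} →
      ∀ᶠ t in 𝓝[≠] (0 : ℂ), ∀ j, ((∃ z : ℂ, ¬ (Bu j z ∈ U ∧ T (Bu j z) = 0)) ∧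
          ((∃ z : ℂ, Bu j z ∈ U ∧ T (Bu j z) = 0) ∨ (Bv j 0 ∈ U ∧ T (Bv j 0) = 0))) →
        (∃ z : ℂ, Bu j z ∈ U ∧ T (Bu j z) = t) ∨ (Bv j 0 ∈ U ∧ T (Bv j 0) = t) := by
    intro T U hU hT hTJ hcl
    refine mem_nhdsWithin_of_mem_nhds (Filter.eventually_all.mpr fun j => ?_)
    obtain ⟨hu, hv, huv, hJu, hJv, -, -, -⟩ := hB j
    by_cases h : (∃ z : ℂ, ¬ (Bu j z ∈ U ∧ T (Bu j z) = 0)) ∧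
        ((∃ z : ℂ, Bu j z ∈ U ∧ T (Bu j z) = 0) ∨ (Bv j 0 ∈ U ∧ T (Bv j 0) = 0))
    · exact (caseB_persist (fun y => JX y) T U (Bu j) (Bv j) hU hT hTJ hcl hu hv huv hJu hJv
        h.1 h.2).mono fun t ht _ => ht
    · exact Filter.Eventually.of_forall fun t h' => absurd h' h
  -- (C) generic small levels `t` (for `TH`) and `s` (for `TV`)
  have hne0 : ∀ᶠ t in 𝓝[≠] (0 : ℂ), t ≠ 0 := self_mem_nhdsWithin
  obtain ⟨t, ht0, ⟨htδ, hgenH⟩, hperH⟩ :=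
    (hne0.and ((caseB_generic TH UH Bu hδ).and (hper TH UH hUH hTH hTHJ hclH))).exists
  obtain ⟨s, hs0, ⟨hsδ, hgenV⟩, hperV⟩ :=
    (hne0.and ((caseB_generic TV UV Bu hδ).and (hper TV UV hUV hTV hTVJ hclV))).exists
  -- (S) counting against `K_t^H`: at most one bubble meets it
  have h₀H : ∃ z : ℂ, ¬ (u₀ z ∈ UH ∧ TH (u₀ z) = t) := ⟨0, fun h => hH₀ h.1⟩
  have hDH := caseB_card_le JX hfact TH UH t u₀ v₀ F₀ m Bu Bv G hUH hTH hTHJ hdTH (hKH t htδ) hu₀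
    hv₀ huv₀ hJu₀ hJv₀ hF₀u hF₀v h₀H hB hsum hgenH
  rw [hcnt t htδ] at hDH
  have hone : ∀ j₁ j₂,
      ((∃ z : ℂ, Bu j₁ z ∈ UH ∧ TH (Bu j₁ z) = t) ∨ (Bv j₁ 0 ∈ UH ∧ TH (Bv j₁ 0) = t)) →
      ((∃ z : ℂ, Bu j₂ z ∈ UH ∧ TH (Bu j₂ z) = t) ∨ (Bv j₂ 0 ∈ UH ∧ TH (Bv j₂ 0) = t)) →
      j₁ = j₂ := by
    intro j₁ j₂ h₁ h₂
    by_contra hne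
    have h := hDH {j₁, j₂} (by
      simp only [Finset.mem_insert, Finset.mem_singleton]
      rintro j (rfl | rfl) <;> assumption)
    rw [Finset.card_pair hne] at h
    norm_num at h
  -- (S) counting against `K_s^V`: the reference count vanishes, so no bubble meets it
  have h₀V : ∃ z : ℂ, ¬ (u₀ z ∈ UV ∧ TV (u₀ z) = s) :=
    ⟨0, fun h => hs0 (h.2.symm.trans (hV₀ 0).2)⟩
  have hDV := caseB_card_le JX hfact TV UV s u₀ v₀ F₀ m Bu Bv G hUV hTV hTVJ hdTV (hKV s hsδ) hu₀
    hv₀ huv₀ hJu₀ hJv₀ hF₀u hF₀v h₀V hB hsum hgenV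
  have hS₁ : {z : ℂ | u₀ z ∈ UV ∧ (fun y => TV y - s) (u₀ z) = 0} = ∅ :=
    Set.eq_empty_of_forall_notMem fun z ⟨_, hz⟩ => hs0 (by simpa [(hV₀ z).2] using hz.symm)
  have hS₂ : {w : ℂ | w = 0 ∧ v₀ w ∈ UV ∧ (fun y => TV y - s) (v₀ w) = 0} = ∅ :=
    Set.eq_empty_of_forall_notMem fun w ⟨hw0, _, hw⟩ => hs0 (by
      subst hw0; simpa [hV₀'.2] using hw.symm)
  rw [hS₁, hS₂, finsum_mem_empty, finsum_mem_empty, add_zero] at hDV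
  have hnone : ∀ j,
      ¬ ((∃ z : ℂ, Bu j z ∈ UV ∧ TV (Bu j z) = s) ∨ (Bv j 0 ∈ UV ∧ TV (Bv j 0) = s)) := by
    intro j hj
    have h := hDV {j} (fun j' hj' => by rwa [Finset.mem_singleton.mp hj'])
    rw [Finset.card_singleton] at h
    norm_num at h
  -- (E) a bubble missing `K_t^H` (there are `m ≥ 2` bubbles); it also misses `K_s^V`
  obtain ⟨j, hj⟩ : ∃ j, ¬ ((∃ z : ℂ, Bu j z ∈ UH ∧ TH (Bu j z) = t) ∨
      (Bv j 0 ∈ UH ∧ TH (Bv j 0) = t)) := by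
    by_contra hall
    push Not at hall
    have h := hone ⟨0, by omega⟩ ⟨1, by omega⟩ (hall _) (hall _)
    simp [Fin.ext_iff] at h
  obtain ⟨-, hv, huv, -, -, -, -, -⟩ := hB j
  exact ⟨j, caseB_conclude hclH hv.continuous huv (hperH j) hj,
    caseB_conclude hclV hv.continuous huv (hperV j) (hnone j)⟩

end Summit.SmoothPoincare4.SmoothPoincare4.Theorems.GromovRecognitionRelEnd.CrossCapLaurent

end
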